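/-
Copyright (c) 2026 the pub-hodgecm-mathlib formalisation cell (harness21).  Prover seat hodgecm-mathlib-F0P3a-p08 (g18): road «S3-tree» ROUTE (A) «SHALIKA» (LEAD F0P3a-plan
(g12), architect A-p16 (g30) ruling A-98 (1)), organ ‹RANK› — `Valued.v` readings at an inert place; 2026-09-01.
-/
import Literature.NumberTheory.LocalFields.UnramifiedQuadraticNormAtInertPlace   -- ★ `exists_mul_galAdicCompletionMap_eq_of_inert`, `exists_isUnit_map_sub_of_residueHom_ne`, the inert residue package
import HarnessLib

/-!
# `U_{F_v} = N U_{E_w}` and a `σ_w`-skew unit at an INERT place, read in Mathlib's `Valued.v` currency of `E_w`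

Topic `NumberTheory/LocalFields`; namespace `Literature.NumberTheory.LocalFields.UnramifiedQuadraticNorm` (= ★ `UnramifiedQuadraticNormAtInertPlace`).  THEOREMS ONLY (no
definition, no instance, no notation, no named fact, no `sorry`); kernel lane.  Cell `pub/hodgecm-mathlib` (D-0151), crux H413 = `stmt-HodgeConjecture-24833`; road «S3-tree»
ROUTE (A) «SHALIKA», organ ‹RANK› (architect A-98 (1); END contract v5 `stub_rankCM`).  A DOCKING file: ★ `exists_mul_galAdicCompletionMap_eq_of_inert` (every `σ_w`-fixed unit
of the `ValuativeRel` valuation ring `𝒪[E_w]` is a norm) and the inert residue package (`σ̄_w = Frob_q ≠ id`, ★ `residueHom_galAdicCompletionMap_eq_pow`,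
`fintypeCard_residueField_eq_sq_of_inert`, `exists_frob_ne`, `exists_isUnit_map_sub_of_residueHom_ne`) are read in the `Valued.v : E_w → ℤᵐ⁰` currency of the unitary
lattice files (`UnramifiedLocalConjDatum`, `IsIntMatrix`, ★ `UnitaryThreeUnipotentClassesUnramified`), the two valuations of `E_w` being equivalent (Mathlib
`ValuativeRel.isEquiv`; the tree registers `Valued.v.Compatible` on adic completions, ★ `AdicCompletionLocalField`).

* `valuation_eq_one_iff_valued_eq_one`, `mem_integer_of_valued_le_one`;
* **`exists_mul_galAdicCompletionMap_eq_of_valued_eq_one`** — `σ_w x = x`, `|x|_w = 1` ⇒ `x = z · σ_w z`;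
* **`exists_galAdicCompletionMap_eq_neg_valued_eq_one`** — there is a `σ_w`-skew UNIT `δ` (`σ_w δ = −δ`, `|δ|_w = 1`): `δ = σ_w a − a` for an integer `a` moved by `σ̄_w`.
HONEST LABEL: HC_CM is proved only modulo the 2 remaining named inputs (hLiu418 24832, h413 24833) until rung 0 closes; nothing printed is asserted here.

## References
* [Serre1979] J.-P. Serre, *Local Fields*, GTM 67 (1979), Ch. V §2 Prop. 3, Corollary and Remark 1 (`U_K = N U_L`, unramified).
* [NeukirchANT1999] J. Neukirch, *Algebraic Number Theory* (1999), Ch. II §4 Prop. (4.3) (the residue extension at an inert place).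
-/

set_option autoImplicit false

noncomputable section

open scoped ValuativeRel
open ValuativeRel NumberField IsDedekindDomain
open Literature.NumberTheory.Automorphic Literature.NumberTheory.Automorphic.UnitaryGroup

namespace Literature.NumberTheory.LocalFields.UnramifiedQuadraticNorm

variable {F E : Type} [Field F] [NumberField F] [Field E] [NumberField E] [Algebra F E]
  [Algebra.IsQuadraticExtension F E] (c : E ≃ₐ[F] E) (v : HeightOneSpectrum (𝓞 F))

omit [NumberField F] [Algebra.IsQuadraticExtension F E] in
/-- The two valuations of `E_w` agree on «`= 1`»: `valuation E_w x = 1 ↔ Valued.v x = 1` (Mathlib `ValuativeRel.isEquiv`). [cite: Serre1979, Ch. II §1] -/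
theorem valuation_eq_one_iff_valued_eq_one (w : PlacesOver E v) (x : w.1.adicCompletion E) :
    valuation (w.1.adicCompletion E) x = 1 ↔ Valued.v x = 1 :=
  (ValuativeRel.isEquiv (valuation (w.1.adicCompletion E)) (Valued.v : Valuation (w.1.adicCompletion E) _)).eq_one_iff_eq_one

omit [NumberField F] [Algebra.IsQuadraticExtension F E] in
/-- `|x|_w ≤ 1 ⇒ x ∈ 𝒪[E_w]` (the `ValuativeRel` valuation ring). [cite: Serre1979, Ch. II §1] -/
theorem mem_integer_of_valued_le_one (w : PlacesOver E v) {x : w.1.adicCompletion E} (hx : Valued.v x ≤ 1) : x ∈ 𝒪[w.1.adicCompletion E] := by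
  rw [Valuation.mem_integer_iff]
  exact ((ValuativeRel.isEquiv (valuation (w.1.adicCompletion E)) (Valued.v : Valuation (w.1.adicCompletion E) _)).le_one_iff_le_one).2 hx

/-- **`U_{F_v} = N U_{E_w}` in `Valued.v` currency**: at an inert place (`c ≠ 1`, `c² = 1`, `v` unramified in `E`, `c • w = w`), every `σ_w`-fixed `x ∈ E_w` with `|x|_w = 1` is a
norm `z · σ_w z` (★ `exists_mul_galAdicCompletionMap_eq_of_inert`). [cite: Serre1979, Ch. V §2 Prop. 3, Corollary and Remark 1] -/
theorem exists_mul_galAdicCompletionMap_eq_of_valued_eq_one (hc : c ≠ 1) (hcc : c * c = 1) (hv : Algebra.IsUnramifiedIn (𝓞 E) v.asIdeal)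
    (w : PlacesOver E v) (hw : c • w.1 = w.1) {x : w.1.adicCompletion E} (hσx : galAdicCompletionMap (L := E) c hw x = x) (hvx : Valued.v x = 1) :
    ∃ z : w.1.adicCompletion E, z * galAdicCompletionMap (L := E) c hw z = x := by
  have hxO : x ∈ 𝒪[w.1.adicCompletion E] := mem_integer_of_valued_le_one v w hvx.le
  have hunit : IsUnit (⟨x, hxO⟩ : 𝒪[w.1.adicCompletion E]) :=
    (Valuation.integer.integers (valuation (w.1.adicCompletion E))).isUnit_iff_valuation_eq_one.2 ((valuation_eq_one_iff_valued_eq_one v w x).2 hvx)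
  obtain ⟨s, hs⟩ := exists_mul_galAdicCompletionMap_eq_of_inert c v hc hcc hv w hw ⟨x, hxO⟩ hunit hσx
  exact ⟨s, hs⟩

/-- **A `σ_w`-SKEW UNIT at an inert place**: there is `δ ∈ E_w` with `σ_w δ = −δ` and `|δ|_w = 1` — `δ = σ_w a − a` for an integer `a` whose residue is moved by
`σ̄_w = Frob_{q_v} ≠ id` (★ `exists_frob_ne`, ★ `exists_isUnit_map_sub_of_residueHom_ne`). [cite: NeukirchANT1999, Ch. II §4 Prop. (4.3)] [cite: Serre1979, Ch. V §2] -/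
theorem exists_galAdicCompletionMap_eq_neg_valued_eq_one (hc : c ≠ 1) (hcc : c * c = 1) (hv : Algebra.IsUnramifiedIn (𝓞 E) v.asIdeal)
    (w : PlacesOver E v) (hw : c • w.1 = w.1) :
    ∃ δ : w.1.adicCompletion E, galAdicCompletionMap (L := E) c hw δ = -δ ∧ Valued.v δ = 1 := by
  obtain ⟨σk, hσk⟩ := exists_residueField_ringHom_galAdicCompletionMap c v w hw
  haveI : Fintype 𝓀[w.1.adicCompletion E] := Fintype.ofFinite _
  have hne := Literature.LinearAlgebra.Matrix.exists_frob_ne (fintypeCard_residueField_eq_sq_of_inert c v hc hv w hw) σk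
    (residueHom_galAdicCompletionMap_eq_pow c v hc hv w hw σk (mem_integer_galAdicCompletionMap c v w hw) hσk)
  obtain ⟨a, ha⟩ := exists_isUnit_map_sub_of_residueHom_ne (galAdicCompletionMap (L := E) c hw) (mem_integer_galAdicCompletionMap c v w hw) σk hσk hne
  refine ⟨galAdicCompletionMap (L := E) c hw a - a, ?_, ?_⟩
  · rw [map_sub, Literature.NumberTheory.Automorphic.Liu2021.galAdicCompletionMap_galAdicCompletionMap_self F E c hcc hw]
    ring
  · exact (valuation_eq_one_iff_valued_eq_one v w _).1
      ((Valuation.integer.integers (valuation (w.1.adicCompletion E))).isUnit_iff_valuation_eq_one.1 ha)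

end Literature.NumberTheory.LocalFields.UnramifiedQuadraticNorm

end
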